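import Summits.Ventures.PercRepro.Night2LocalTwoTwo

/-!
# PercRepro — LEMMA X: a coloop-free shadow set has at most `8` far preimages (`q = 3`, `|E ∖ G| = 2`) (night-2, gen 9)

At a rank-`4` flat `G` with `|E ∖ G| = 2` of a loopless matroid, a far preimage `B` of a shadow set `S` gives
the pair `P = S ∖ B ⊆ S` with `G ∖ P = cl B` a rank-`3` flat.  Rank counting (submodularity on these flats,
with `ρ(G ∖ x) = 4` for the non-coloops `x` of `S`) shows that the pairs cannot be numerous:
* three pairs at one element `a` (`{a,b}, {a,c}, {a,d}`) force `ρ(G ∖ {a,b,c,d}) ≤ 1`, after which every other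
  pair `P` lies inside `{a,b,c,d}` — a pair disjoint from it gives `ρ(G ∖ {a,b,c,d} ∖ P) = 0`, i.e. `G = {a,b,c,d} ∪ P`;
  a pair `{x, e}` with `e ∉ {a,b,c,d}` puts every element of `G ∖ {a,b,c,d}` other than `e` parallel to `e` inside the
  flat `G ∖ {x,e} ∌ e`, so `G = {a,b,c,d,e}`; in both cases `G = S` and a member `B = S ∖ P` has
  `E ∖ B = P ∪ (E ∖ G)` of rank `≤ 4 < 5` — so at most `6` pairs;
* otherwise every element is in at most two pairs: two pairs `{a,b}, {b,c}` at `b` force `ρ(G ∖ {a,b,c}) ≤ 2`, at most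
  one further pair is disjoint from `{a,b,c}` (two such give rank `0`), and at most `6` pairs meet `{a,b,c}` — so at most
  `7`; and pairwise disjoint pairs number at most `3` (four give rank `0`).
This module: the rank tools, the far pairs, and the three-pairs-at-one-element case (every far pair then lies
inside `{a, b, c, d}`); `Night2LocalTwoTwoY` finishes the count (`card_farPre_le_eight_of_coloops_eq_zero`) and
states the theorem `localShadowHall_two_two`.
-/

namespace PercRepro.Shadow

open Finset PerFlat ThmH

variable {α : Type*} [DecidableEq α] {M : Matroid α} [M.Finite]

/-! ## Rank tools -/

/-- Submodularity for `rkN`. -/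
theorem rkN_inter_add_rkN_union_le (X Y : Finset α) :
    rkN M (X ∩ Y) + rkN M (X ∪ Y) ≤ rkN M X + rkN M Y := by
  have := M.eRk_inter_add_eRk_union_le (X : Set α) (Y : Set α)
  rw [← Finset.coe_inter, ← Finset.coe_union, eRk_eq_rkN, eRk_eq_rkN, eRk_eq_rkN, eRk_eq_rkN] at this
  exact_mod_cast this

omit [DecidableEq α] in
/-- In a loopless matroid a subset of the ground set of rank `0` is empty. -/
theorem eq_empty_of_rkN_eq_zero (hl : ∀ e ∈ gr M, M.IsNonloop e) {X : Finset α} (hX : X ⊆ gr M)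
    (h : rkN M X = 0) : X = ∅ := by
  by_contra hne
  obtain ⟨e, he⟩ := Finset.nonempty_iff_ne_empty.2 hne
  have h1 : M.eRk ({e} : Set α) ≤ M.eRk (X : Set α) :=
    M.eRk_mono (by rw [← Finset.coe_singleton]; exact_mod_cast Finset.singleton_subset_iff.2 he)
  rw [(hl e (hX he)).eRk_eq, eRk_eq_rkN, h] at h1
  exact absurd h1 (by decide)

omit [DecidableEq α] in
/-- Two elements of a rank-`≤ 1` set are parallel: `e ∈ cl {g}`. -/
theorem mem_clF_singleton_of_rkN_le_one {F : Finset α} (hF : F ⊆ gr M) (hr : rkN M F ≤ 1) {e g : α}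
    (he : e ∈ F) (hg : g ∈ F) (hgn : M.IsNonloop g) : e ∈ clF M {g} := by
  by_contra hcl
  have heE : e ∈ M.E \ M.closure ({g} : Set α) := by
    refine ⟨by rw [← coe_gr]; exact_mod_cast hF he, ?_⟩
    intro h
    apply hcl
    rw [← Finset.mem_coe, coe_clF, Finset.coe_singleton]
    exact h
  have h1 : M.eRk (insert e ({g} : Set α)) = M.eRk ({g} : Set α) + 1 := Matroid.eRk_insert_eq_add_one heE
  rw [hgn.eRk_eq] at h1
  have h2 : M.eRk (insert e ({g} : Set α)) ≤ M.eRk (F : Set α) := by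
    apply M.eRk_mono
    intro x hx
    rw [Set.mem_insert_iff, Set.mem_singleton_iff] at hx
    rcases hx with rfl | rfl
    · exact_mod_cast he
    · exact_mod_cast hg
  rw [h1, eRk_eq_rkN] at h2
  have : 1 + 1 ≤ rkN M F := by exact_mod_cast h2
  omega

/-! ## The pairs of a coloop-free shadow set -/

open scoped Classical in
/-- The pairs of the far preimages of `S`. -/
noncomputable def farPairs (M : Matroid α) [M.Finite] (q : ℕ) (G S : Finset α) : Finset (Finset α) :=
  (farPre M q G S).image (fun B => S \ B)

open scoped Classical in
/-- `#farPairs = #farPre`. -/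
theorem card_farPairs {q : ℕ} (G S : Finset α) : (farPairs M q G S).card = (farPre M q G S).card := by
  unfold farPairs
  apply Finset.card_image_of_injOn
  intro B hB B' hB' hBB'
  rw [Finset.mem_coe, mem_farPre] at hB hB'
  have h1 : B ⊆ S := by rw [hB.2.2]; exact Finset.subset_union_left
  have h2 : B' ⊆ S := by rw [hB'.2.2]; exact Finset.subset_union_left
  have h3 : S \ B = S \ B' := hBB'
  calc B = S \ (S \ B) := (Finset.sdiff_sdiff_eq_self h1).symm
    _ = S \ (S \ B') := by rw [h3]
    _ = B' := Finset.sdiff_sdiff_eq_self h2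

open scoped Classical in
/-- A far pair `P = S ∖ B`: `P ⊆ S`, `#P = 2`, and `G ∖ P = cl B` is a flat of rank `3`. -/
theorem farPair_facts {G S : Finset α} {P : Finset α} (hP : P ∈ farPairs M 3 G S) :
    P ⊆ S ∧ P.card = 2 ∧ ∃ B ∈ farPre M 3 G S, P = S \ B ∧ G \ P = clF M B ∧ rkN M (clF M B) = 3 ∧
      clF M (clF M B) = clF M B := by
  unfold farPairs at hP
  rw [Finset.mem_image] at hP
  obtain ⟨B, hB, rfl⟩ := hP
  have hB' := hB
  rw [mem_farPre] at hB'
  obtain ⟨hBm, hcard2, hSeq⟩ := hB'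
  have hBU : B ∈ Uq M 5 3 := (mem_membersIn.1 hBm).1
  have hBG : clF M B ⊆ G := (mem_membersIn.1 hBm).2
  have hdisj : Disjoint B (G \ clF M B) :=
    Finset.disjoint_of_subset_left (subset_clF hBU) Finset.disjoint_sdiff
  have hSB : S \ B = G \ clF M B := by rw [hSeq, Finset.union_sdiff_cancel_left hdisj]
  refine ⟨Finset.sdiff_subset, by rw [hSB]; exact hcard2, B, hB, rfl, ?_, ?_, ?_⟩
  · rw [hSB, Finset.sdiff_sdiff_eq_self hBG]
  · unfold rkN
    rw [coe_clF, M.eRk_closure_eq, (mem_Uq.1 hBU).2.1]; rfl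
  · rw [← Finset.coe_inj, coe_clF, coe_clF, Matroid.closure_closure]

open scoped Classical in
/-- `G ∖ P` has rank `3` for a far pair `P`. -/
theorem rkN_sdiff_farPair {G S : Finset α} {P : Finset α} (hP : P ∈ farPairs M 3 G S) :
    rkN M (G \ P) = 3 := by
  obtain ⟨-, -, B, -, -, hGP, hr, -⟩ := farPair_facts hP
  rw [hGP, hr]

open scoped Classical in
/-- An element of a shadow set that is not a coloop of it: `ρ(G ∖ x) = 4`. -/
theorem rkN_erase_of_notMem_coloops {G : Finset α} (hG : G ∈ flatsQ M 4) {S : Finset α}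
    (hS : S ∈ shadowAt M 5 3 (Uq M 5 3) G) {x : α} (hxS : x ∈ S) (hx : x ∉ coloops M S) :
    rkN M (G.erase x) = 4 := by
  have hSG : S ⊆ G := subset_of_mem_shadowAt hS
  have hGg : G ⊆ gr M := (mem_flatsQ.1 hG).1
  have hGr : rkN M G = 4 := by unfold rkN; rw [(mem_flatsQ.1 hG).2.2]; rfl
  rw [mem_coloops] at hx
  push Not at hx
  have hxcl : x ∈ clF M (S.erase x) := hx hxS
  have hxcl' : x ∈ clF M (G.erase x) := clF_mono (Finset.erase_subset_erase x hSG) hxcl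
  have hsub : G ⊆ clF M (G.erase x) := by
    intro e he
    by_cases hex : e = x
    · rw [hex]; exact hxcl'
    · have : e ∈ G.erase x := Finset.mem_erase.2 ⟨hex, he⟩
      exact subset_clF_of_subset_gr ((Finset.erase_subset _ _).trans hGg) this
  apply le_antisymm
  · rw [← hGr]; exact rkN_mono (Finset.erase_subset _ _)
  · have h1 : rkN M G ≤ rkN M (clF M (G.erase x)) := rkN_mono hsub
    have h2 : rkN M (clF M (G.erase x)) = rkN M (G.erase x) := by
      unfold rkN; rw [coe_clF, M.eRk_closure_eq]
    rw [hGr] at h1; rw [h2] at h1; exact h1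

open scoped Classical in
/-- **The contradiction**: if `G ⊆ S` then no far preimage exists (`E ∖ B = (E ∖ G) ∪ (S ∖ B)` has rank `≤ 4`). -/
theorem farPre_eq_empty_of_subset {G : Finset α} (hd : (gr M \ G).card = 2)
    {S : Finset α} (hS : S ∈ shadowAt M 5 3 (Uq M 5 3) G) (hGS : G ⊆ S) {B : Finset α}
    (hB : B ∈ farPre M 3 G S) : False := by
  have hSG : S ⊆ G := subset_of_mem_shadowAt hS
  have hSeqG : S = G := le_antisymm hSG hGS
  rw [mem_farPre] at hB
  obtain ⟨hBm, hcard2, hSeq⟩ := hB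
  have hBU : B ∈ Uq M 5 3 := (mem_membersIn.1 hBm).1
  have hBc : M.eRk ((gr M \ B : Finset α) : Set α) = ((5 : ℕ) : ℕ∞) := (mem_Uq.1 hBU).2.2
  have hBS : B ⊆ S := by rw [hSeq]; exact Finset.subset_union_left
  have hsub : gr M \ B ⊆ (gr M \ G) ∪ (S \ B) := by
    intro e he
    rw [Finset.mem_sdiff] at he
    rw [Finset.mem_union, Finset.mem_sdiff, Finset.mem_sdiff]
    by_cases heG : e ∈ G
    · exact Or.inr ⟨hSeqG ▸ heG, he.2⟩
    · exact Or.inl ⟨he.1, heG⟩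
  have hdisj : Disjoint B (G \ clF M B) :=
    Finset.disjoint_of_subset_left (subset_clF hBU) Finset.disjoint_sdiff
  have hSB : (S \ B).card = 2 := by rw [hSeq, Finset.union_sdiff_cancel_left hdisj]; exact hcard2
  have hcard : ((gr M \ G) ∪ (S \ B)).card ≤ 4 := by
    calc ((gr M \ G) ∪ (S \ B)).card ≤ (gr M \ G).card + (S \ B).card := Finset.card_union_le _ _
      _ = 4 := by rw [hd, hSB]
  have h1 : M.eRk ((gr M \ B : Finset α) : Set α) ≤ M.eRk (((gr M \ G) ∪ (S \ B) : Finset α) : Set α) :=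
    M.eRk_mono (by exact_mod_cast hsub)
  have h2 := M.eRk_le_encard (((gr M \ G) ∪ (S \ B) : Finset α) : Set α)
  rw [Set.encard_coe_eq_coe_finsetCard] at h2
  rw [hBc] at h1
  have h3 : ((5 : ℕ) : ℕ∞) ≤ ((((gr M \ G) ∪ (S \ B)).card : ℕ) : ℕ∞) := h1.trans h2
  have h4 : 5 ≤ ((gr M \ G) ∪ (S \ B)).card := by exact_mod_cast h3
  omega

open scoped Classical in
/-- A set `W ⊆ S` with `ρ(G ∖ W) = 0` forces `G ⊆ S` (loopless), hence no far preimage. -/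
theorem false_of_rkN_sdiff_eq_zero (hl : ∀ e ∈ gr M, M.IsNonloop e) {G : Finset α} (hG : G ∈ flatsQ M 4)
    (hd : (gr M \ G).card = 2) {S : Finset α} (hS : S ∈ shadowAt M 5 3 (Uq M 5 3) G) {W : Finset α}
    (hW : W ⊆ S) (hr : rkN M (G \ W) = 0) {B : Finset α} (hB : B ∈ farPre M 3 G S) : False := by
  have hGg : G ⊆ gr M := (mem_flatsQ.1 hG).1
  have hempty : G \ W = ∅ := eq_empty_of_rkN_eq_zero hl (Finset.sdiff_subset.trans hGg) hr
  rw [Finset.sdiff_eq_empty_iff_subset] at hempty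
  exact farPre_eq_empty_of_subset hd hS (hempty.trans hW) hB

/-! ## Three pairs at one element -/

open scoped Classical in
/-- Two far pairs `{a, b}`, `{a, c}` at `a`: `ρ(G ∖ {a, b, c}) ≤ 2`. -/
theorem rkN_three_le_two {G : Finset α} (hG : G ∈ flatsQ M 4) {S : Finset α}
    (hS : S ∈ shadowAt M 5 3 (Uq M 5 3) G) (h0 : (coloops M S).card = 0) {a b c : α}
    (hab : ({a, b} : Finset α) ∈ farPairs M 3 G S) (hac : ({a, c} : Finset α) ∈ farPairs M 3 G S)
    (hbc : b ≠ c) : rkN M (G \ {a, b, c}) ≤ 2 := by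
  have haS : a ∈ S := (farPair_facts hab).1 (by simp)
  have hanc : a ∉ coloops M S := by
    intro h; have := Finset.card_pos.2 ⟨a, h⟩; omega
  have h1 := rkN_sdiff_farPair hab
  have h2 := rkN_sdiff_farPair hac
  have hinter : (G \ {a, b}) ∩ (G \ {a, c}) = G \ {a, b, c} := by
    ext e; simp only [Finset.mem_inter, Finset.mem_sdiff, Finset.mem_insert, Finset.mem_singleton]; tauto
  have hunion : (G \ {a, b}) ∪ (G \ {a, c}) = G.erase a := by
    ext e; simp only [Finset.mem_union, Finset.mem_sdiff, Finset.mem_insert, Finset.mem_singleton,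
      Finset.mem_erase]
    constructor
    · rintro (⟨he, h⟩ | ⟨he, h⟩)
      · exact ⟨fun h' => h (Or.inl h'), he⟩
      · exact ⟨fun h' => h (Or.inl h'), he⟩
    · rintro ⟨hea, he⟩
      by_cases heb : e = b
      · right; exact ⟨he, fun h => by rcases h with h | h; exact hea h; exact hbc (heb.symm.trans h)⟩
      · left; exact ⟨he, fun h => by rcases h with h | h; exact hea h; exact heb h⟩
  have hsub : rkN M ((G \ {a, b}) ∩ (G \ {a, c})) + rkN M ((G \ {a, b}) ∪ (G \ {a, c})) ≤
      rkN M (G \ {a, b}) + rkN M (G \ {a, c}) := rkN_inter_add_rkN_union_le _ _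
  rw [hinter, hunion, h1, h2, rkN_erase_of_notMem_coloops hG hS haS hanc] at hsub
  omega

open scoped Classical in
/-- Three far pairs `{a, b}`, `{a, c}`, `{a, d}` at `a`: `ρ(G ∖ {a, b, c, d}) ≤ 1`. -/
theorem rkN_four_le_one {G : Finset α} (hG : G ∈ flatsQ M 4) {S : Finset α}
    (hS : S ∈ shadowAt M 5 3 (Uq M 5 3) G) (h0 : (coloops M S).card = 0) {a b c d : α}
    (hab : ({a, b} : Finset α) ∈ farPairs M 3 G S) (hac : ({a, c} : Finset α) ∈ farPairs M 3 G S)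
    (had : ({a, d} : Finset α) ∈ farPairs M 3 G S) (hbc : b ≠ c) (hbd : b ≠ d) (hcd : c ≠ d) :
    rkN M (G \ {a, b, c, d}) ≤ 1 := by
  have haS : a ∈ S := (farPair_facts hab).1 (by simp)
  have hanc : a ∉ coloops M S := by
    intro h; have := Finset.card_pos.2 ⟨a, h⟩; omega
  have h1 := rkN_three_le_two hG hS h0 hab hac hbc
  have h2 := rkN_sdiff_farPair had
  have hinter : (G \ {a, b, c}) ∩ (G \ {a, d}) = G \ {a, b, c, d} := by
    ext e; simp only [Finset.mem_inter, Finset.mem_sdiff, Finset.mem_insert, Finset.mem_singleton]; tauto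
  have hunion : (G \ {a, b, c}) ∪ (G \ {a, d}) = G.erase a := by
    ext e; simp only [Finset.mem_union, Finset.mem_sdiff, Finset.mem_insert, Finset.mem_singleton,
      Finset.mem_erase]
    constructor
    · rintro (⟨he, h⟩ | ⟨he, h⟩)
      · exact ⟨fun h' => h (Or.inl h'), he⟩
      · exact ⟨fun h' => h (Or.inl h'), he⟩
    · rintro ⟨hea, he⟩
      by_cases hed : e = d
      · left; exact ⟨he, fun h => by
          rcases h with h | h | h
          · exact hea h
          · exact hbd (hed ▸ h).symm
          · exact hcd (hed ▸ h).symm⟩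
      · right; exact ⟨he, fun h => by rcases h with h | h; exact hea h; exact hed h⟩
  have hsub : rkN M ((G \ {a, b, c}) ∩ (G \ {a, d})) + rkN M ((G \ {a, b, c}) ∪ (G \ {a, d})) ≤
      rkN M (G \ {a, b, c}) + rkN M (G \ {a, d}) := rkN_inter_add_rkN_union_le _ _
  rw [hinter, hunion, h2, rkN_erase_of_notMem_coloops hG hS haS hanc] at hsub
  omega

/-! ## Every far pair lies inside `{a, b, c, d}` once three pairs meet at `a` -/

open scoped Classical in
/-- A far pair `P` disjoint from a set `W ⊆ S` with `ρ(G ∖ W) ≤ 1` cannot exist. -/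
theorem false_of_disjoint_pair (hl : ∀ e ∈ gr M, M.IsNonloop e) {G : Finset α} (hG : G ∈ flatsQ M 4)
    (hd : (gr M \ G).card = 2) {S : Finset α} (hS : S ∈ shadowAt M 5 3 (Uq M 5 3) G) {W : Finset α}
    (hW : W ⊆ S) (hr : rkN M (G \ W) ≤ 1) {P : Finset α} (hP : P ∈ farPairs M 3 G S)
    (hdisj : Disjoint W P) : False := by
  obtain ⟨hPS, -, B, hB, -, -, -, -⟩ := farPair_facts hP
  have h1 := rkN_sdiff_farPair hP
  have hGr : rkN M G = 4 := by unfold rkN; rw [(mem_flatsQ.1 hG).2.2]; rfl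
  have hinter : (G \ W) ∩ (G \ P) = G \ (W ∪ P) := by
    ext e; simp only [Finset.mem_inter, Finset.mem_sdiff, Finset.mem_union]; tauto
  have hunion : (G \ W) ∪ (G \ P) = G := by
    ext e; simp only [Finset.mem_union, Finset.mem_sdiff]
    constructor
    · rintro (h | h) <;> exact h.1
    · intro he
      by_cases heW : e ∈ W
      · exact Or.inr ⟨he, Finset.disjoint_left.1 hdisj heW⟩
      · exact Or.inl ⟨he, heW⟩
  have hsub : rkN M ((G \ W) ∩ (G \ P)) + rkN M ((G \ W) ∪ (G \ P)) ≤ rkN M (G \ W) + rkN M (G \ P) :=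
    rkN_inter_add_rkN_union_le _ _
  rw [hinter, hunion, hGr, h1] at hsub
  exact false_of_rkN_sdiff_eq_zero hl hG hd hS (Finset.union_subset hW hPS) (by omega) hB

open scoped Classical in
/-- With three far pairs at `a`, every far pair lies inside `{a, b, c, d}`. -/
theorem farPair_subset_four (hl : ∀ e ∈ gr M, M.IsNonloop e) {G : Finset α} (hG : G ∈ flatsQ M 4)
    (hd : (gr M \ G).card = 2) {S : Finset α} (hS : S ∈ shadowAt M 5 3 (Uq M 5 3) G)
    (h0 : (coloops M S).card = 0) {a b c d : α}
    (hab : ({a, b} : Finset α) ∈ farPairs M 3 G S) (hac : ({a, c} : Finset α) ∈ farPairs M 3 G S)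
    (had : ({a, d} : Finset α) ∈ farPairs M 3 G S) (hbc : b ≠ c) (hbd : b ≠ d) (hcd : c ≠ d)
    {P : Finset α} (hP : P ∈ farPairs M 3 G S) : P ⊆ ({a, b, c, d} : Finset α) := by
  have hr := rkN_four_le_one hG hS h0 hab hac had hbc hbd hcd
  have hSG : S ⊆ G := subset_of_mem_shadowAt hS
  have hGg : G ⊆ gr M := (mem_flatsQ.1 hG).1
  have hW : ({a, b, c, d} : Finset α) ⊆ S := by
    intro e he
    simp only [Finset.mem_insert, Finset.mem_singleton] at he
    rcases he with rfl | rfl | rfl | rfl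
    · exact (farPair_facts hab).1 (by simp)
    · exact (farPair_facts hab).1 (by simp)
    · exact (farPair_facts hac).1 (by simp)
    · exact (farPair_facts had).1 (by simp)
  obtain ⟨hPS, hP2, B, hB, hPeq, hGP, -, hflat⟩ := farPair_facts hP
  by_contra hnot
  obtain ⟨e, heP, heW⟩ := Finset.not_subset.1 hnot
  by_cases hmeet : Disjoint ({a, b, c, d} : Finset α) P
  · exact false_of_disjoint_pair hl hG hd hS hW hr hP hmeet
  · -- `P = {x, e}` with `x ∈ {a,b,c,d}`: every element of `G ∖ {a,b,c,d}` other than `e` is parallel to `e`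
    rw [Finset.not_disjoint_iff] at hmeet
    obtain ⟨x, hxW, hxP⟩ := hmeet
    have heS : e ∈ S := hPS heP
    have heG : e ∈ G := hSG heS
    have hen : M.IsNonloop e := hl e (hGg heG)
    -- `G ∖ {a,b,c,d} ⊆ {e}`
    have hF0 : G \ ({a, b, c, d} : Finset α) ⊆ {e} := by
      intro g hg
      rw [Finset.mem_singleton]
      by_contra hge
      have hgP : g ∉ P := by
        intro hgP
        -- `P = {x, e}` has two elements, `g ∈ P`, `g ≠ e` forces `g = x ∈ {a,b,c,d}`
        obtain ⟨u, v, huv, hPuv⟩ := Finset.card_eq_two.1 hP2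
        rw [hPuv, Finset.mem_insert, Finset.mem_singleton] at hxP heP hgP
        have hgW : g ∉ ({a, b, c, d} : Finset α) := (Finset.mem_sdiff.1 hg).2
        rcases hxP with rfl | rfl <;> rcases heP with rfl | rfl <;> rcases hgP with rfl | rfl <;>
          first | exact hgW hxW | exact heW hxW | exact hge rfl
      -- `e ∈ cl {g} ⊆ cl (G ∖ P) = G ∖ P`, contradicting `e ∈ P`
      have hge' : e ∈ clF M {g} :=
        mem_clF_singleton_of_rkN_le_one (Finset.sdiff_subset.trans hGg) hr
          (Finset.mem_sdiff.2 ⟨heG, heW⟩) hg (hl g (hGg (Finset.mem_sdiff.1 hg).1))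
      have hgGP : g ∈ G \ P := Finset.mem_sdiff.2 ⟨(Finset.mem_sdiff.1 hg).1, hgP⟩
      have : e ∈ clF M (G \ P) := clF_mono (Finset.singleton_subset_iff.2 hgGP) hge'
      rw [hGP, hflat, ← hGP] at this
      exact (Finset.mem_sdiff.1 this).2 heP
    -- hence `G ⊆ {a,b,c,d,e} ⊆ S`
    have hGS : G ⊆ S := by
      intro g hg
      by_cases hgW : g ∈ ({a, b, c, d} : Finset α)
      · exact hW hgW
      · have := hF0 (Finset.mem_sdiff.2 ⟨hg, hgW⟩)
        rw [Finset.mem_singleton] at this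
        rw [this]; exact heS
    exact farPre_eq_empty_of_subset hd hS hGS hB

end PercRepro.Shadow
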